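import Mathlib
import Literature.Computability.AlgebraicComplexity.MatrixMultiplicationExponent
import Literature.Computability.AlgebraicComplexity.AlderStrassen
import Summits.MatrixMultiplication.MatrixMultiplication.Theorems.FidelityWitnessesLinearDefectLawStubOneStepGain

/-!
# `FidelityWitnesses.LinearDefectLaw`, line `border-singular-values`: `stub_criticalGram`

Support file for crux item `stmt-MatrixMultiplication-14039`
(`Summit.MatrixMultiplication.MatrixMultiplication.Theses.FidelityWitnesses.LinearDefectLaw`), line
`border-singular-values` (reshape r1), registered stub `stub_criticalGram` — FIRST-ORDER OPTIMALITY of a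
fidelity maximiser under the three mode actions of `GL(n²)`: the critical Gram identity
`S_(p) T_(p)^* = S_(p) S_(p)^*` in the three modes `p = A, B, C`.

Notation (`T = ⟨n,n,n⟩ = matMulTensor ℂ n n n`, entries `0/1`, hence real): `ov S := Σ S·T ∈ ℂ`,
`ns S := Σ ‖S abc‖² ∈ ℝ`, `C_r := closure {S' | tensorRank S' ≤ r}` (product topology on the finite
function type).  Hypotheses: `S ∈ C_r`, `S ≠ 0`, optimal scale `ov S = ns S =: N`, and `S` maximises the
fidelity against honest rank-`≤ r` tensors: `|ov S'|² ≤ N · ns S'`.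

Proof.
1. The maximiser inequality extends to `C_r` (`isClosed_le` + `closure_minimal`): `max_on_closure`.
2. Mode deformations stay in `C_r`: for a vector `x` and a slot index `a₀` the map
   `S' ↦ (p b c ↦ S' p b c + x p · S' a₀ b c)` is continuous and preserves `{rank ≤ r}` (it acts on the
   first factors of a triad decomposition), hence preserves `C_r` (`map_mem_closure`):
   `deform_mem_closure`.
3. The quadratic: with `D := e_{a₁} ⊗ S_{a₀••}` and `S_z := S + z D ∈ C_r` (`z ∈ ℂ`),
   `|N + zβ|² ≤ N (N + 2 Re (z γ) + |z|² ns D)` where `β := ov D`, `γ := ⟪S, D⟫`; along `z = t ∈ ℝ`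
   the linear term forces `Re β = Re γ` (`eq_zero_of_forall_mul_le_mul_sq`), along `z = it` it forces
   `Im β = Im γ`; so `β = γ` (`first_order`, flattened over one index in `flat_first_order`).
4. Unfolding `D`: `Σ_{bc} S a₀ b c T a₁ b c = Σ_{bc} S a₀ b c conj (S a₁ b c)` — mode A (`modeA`, for any
   real tensor `T` over arbitrary finite index types).  Modes B and C are mode A for the re-indexed
   tensors `(b a c ↦ S a b c)`, `(c a b ↦ S a b c)`: rank and closure transport along the (continuous,
   rank-preserving) slot permutations, the sums by `Finset.sum_comm`.
Mathlib only, plus the tree definitions `triad`, `tensorRank`, `matMulTensor`, the tree lemmas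
`tensorRank_le_of_eq_sum`, `exists_eq_sum_triad_of_tensorRank_le`, and two bookkeeping lemmas of the sibling
stub file `…StubOneStepGain` (`sum_norm_sq_pos_of_ne_zero`, `conj_matMulTensor`).
-/

set_option linter.dupNamespace false

namespace Summit.MatrixMultiplication.MatrixMultiplication.Theorems.LinearDefectLaw.CriticalGram

open scoped BigOperators ComplexConjugate Topology
open Filter Literature.Computability.AlgebraicComplexity

/-! ## Real and Hermitian bookkeeping -/

/-- A real affine function dominated by a quadratic through the origin vanishes:
`(∀ t, a t ≤ b t²) → a = 0` (divide by `t > 0` and let `t → 0⁺`, for `a` and for `-a`). -/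
theorem eq_zero_of_forall_mul_le_mul_sq {a b : ℝ} (h : ∀ t : ℝ, a * t ≤ b * t ^ 2) : a = 0 := by
  have key : ∀ a' : ℝ, (∀ t : ℝ, a' * t ≤ b * t ^ 2) → a' ≤ 0 := by
    intro a' h'
    have lim : Tendsto (fun t : ℝ => b * t) (𝓝[>] 0) (𝓝 0) :=
      ((continuous_const_mul b).tendsto' 0 0 (mul_zero b)).mono_left nhdsWithin_le_nhds
    refine ge_of_tendsto lim ?_
    filter_upwards [self_mem_nhdsWithin] with t ht
    have h1 : a' * t ≤ b * t * t := by
      rw [mul_assoc, ← pow_two]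
      exact h' t
    exact le_of_mul_le_mul_right h1 ht
  have h1 := key a h
  have h2 := key (-a) fun t => by nlinarith [h (-t)]
  linarith

/-- Entrywise polarisation along a real parameter:
`‖z + t w‖² = ‖z‖² + 2 t Re (conj z · w) + t² ‖w‖²`. -/
theorem norm_add_ofReal_mul_sq (z w : ℂ) (t : ℝ) :
    ‖z + t * w‖ ^ 2 = ‖z‖ ^ 2 + 2 * t * (conj z * w).re + t ^ 2 * ‖w‖ ^ 2 := by
  simp only [Complex.sq_norm, Complex.normSq_apply, Complex.add_re, Complex.add_im, Complex.mul_re,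
    Complex.mul_im, Complex.ofReal_re, Complex.ofReal_im, Complex.conj_re, Complex.conj_im]
  ring

/-- Three nested finite sums, cyclically re-ordered: `Σ_c Σ_a Σ_b f a b c = Σ_a Σ_b Σ_c f a b c`. -/
theorem sum_cyc {α β γ : Type*} [Fintype α] [Fintype β] [Fintype γ] {M : Type*} [AddCommMonoid M]
    (f : α → β → γ → M) : ∑ c, ∑ a, ∑ b, f a b c = ∑ a, ∑ b, ∑ c, f a b c :=
  Finset.sum_comm.trans (Finset.sum_congr rfl fun _ _ => Finset.sum_comm)

/-! ## The first-order condition along a complex line -/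

/-- **First-order condition, flattened.** `S, D, T` complex vectors on one finite index, `N > 0`,
`Σ S T = N = Σ ‖S‖²`, and `|Σ (S + zD) T|² ≤ N Σ ‖S + zD‖²` for every `z ∈ ℂ` (equality at `z = 0`).
Then `Σ D T = Σ conj S · D`: the real line `z = t` gives the real parts
(`eq_zero_of_forall_mul_le_mul_sq` on the linear term of the quadratic in `t`), the imaginary line
`z = it` the imaginary parts. -/
theorem flat_first_order {ι : Type*} [Fintype ι] (S D T : ι → ℂ) (N : ℝ) (hN : 0 < N)
    (hov : ∑ i, S i * T i = (N : ℂ)) (hns : ∑ i, ‖S i‖ ^ 2 = N)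
    (h : ∀ z : ℂ, ‖∑ i, (S i + z * D i) * T i‖ ^ 2 ≤ N * ∑ i, ‖S i + z * D i‖ ^ 2) :
    ∑ i, D i * T i = ∑ i, conj (S i) * D i := by
  -- real parts, for an arbitrary direction `D'` deformed along the real line
  have re_part : ∀ D' : ι → ℂ,
      (∀ t : ℝ, ‖∑ i, (S i + t * D' i) * T i‖ ^ 2 ≤ N * ∑ i, ‖S i + t * D' i‖ ^ 2) →
      (∑ i, D' i * T i).re = (∑ i, conj (S i) * D' i).re := by
    intro D' h'
    obtain ⟨β, hβ⟩ : ∃ β : ℂ, ∑ i, D' i * T i = β := ⟨_, rfl⟩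
    obtain ⟨γ, hγ⟩ : ∃ γ : ℂ, ∑ i, conj (S i) * D' i = γ := ⟨_, rfl⟩
    obtain ⟨M, hM⟩ : ∃ M : ℝ, ∑ i, ‖D' i‖ ^ 2 = M := ⟨_, rfl⟩
    rw [hβ, hγ]
    have key : ∀ t : ℝ, (2 * N * (β.re - γ.re)) * t ≤ (N * M - ‖β‖ ^ 2) * t ^ 2 := by
      intro t
      have h1 : ∑ i, (S i + t * D' i) * T i = N + t * β := by
        rw [← hov, ← hβ, Finset.mul_sum, ← Finset.sum_add_distrib]
        exact Finset.sum_congr rfl fun i _ => by ring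
      have h2 : ∑ i, ‖S i + t * D' i‖ ^ 2 = N + 2 * t * γ.re + t ^ 2 * M := by
        rw [← hns, ← hγ, ← hM, Complex.re_sum, Finset.mul_sum, Finset.mul_sum,
          ← Finset.sum_add_distrib, ← Finset.sum_add_distrib]
        exact Finset.sum_congr rfl fun i _ => norm_add_ofReal_mul_sq (S i) (D' i) t
      have h3 : ‖(N : ℂ) + t * β‖ ^ 2 = N ^ 2 + 2 * N * t * β.re + t ^ 2 * ‖β‖ ^ 2 := by
        simp only [Complex.sq_norm, Complex.normSq_apply, Complex.add_re, Complex.add_im,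
          Complex.mul_re, Complex.mul_im, Complex.ofReal_re, Complex.ofReal_im]
        ring
      have h4 := h' t
      rw [h1, h2, h3] at h4
      nlinarith [h4]
    have h0 := eq_zero_of_forall_mul_le_mul_sq key
    have h2N : (2 * N) ≠ 0 := by positivity
    linarith [(mul_eq_zero.1 h0).resolve_left h2N]
  apply Complex.ext
  · exact re_part D fun t => h t
  · have him : (∑ i, Complex.I * D i * T i).re = (∑ i, conj (S i) * (Complex.I * D i)).re :=
      re_part (fun i => Complex.I * D i) fun t => by simpa only [mul_assoc] using h (t * Complex.I)
    have e1 : ∑ i, Complex.I * D i * T i = Complex.I * ∑ i, D i * T i := by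
      rw [Finset.mul_sum]
      exact Finset.sum_congr rfl fun i _ => by ring
    have e2 : ∑ i, conj (S i) * (Complex.I * D i) = Complex.I * ∑ i, conj (S i) * D i := by
      rw [Finset.mul_sum]
      exact Finset.sum_congr rfl fun i _ => by ring
    rw [e1, e2, Complex.I_mul_re, Complex.I_mul_re, neg_inj] at him
    exact him

/-- **First-order condition, three-slot format** (`flat_first_order` transported along
`Fintype.sum_prod_type`). -/
theorem first_order {α β γ : Type*} [Fintype α] [Fintype β] [Fintype γ] (S D T : α → β → γ → ℂ)
    (N : ℝ) (hN : 0 < N) (hov : ∑ a, ∑ b, ∑ c, S a b c * T a b c = (N : ℂ))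
    (hns : ∑ a, ∑ b, ∑ c, ‖S a b c‖ ^ 2 = N)
    (h : ∀ z : ℂ, ‖∑ a, ∑ b, ∑ c, (S a b c + z * D a b c) * T a b c‖ ^ 2 ≤
      N * ∑ a, ∑ b, ∑ c, ‖S a b c + z * D a b c‖ ^ 2) :
    ∑ a, ∑ b, ∑ c, D a b c * T a b c = ∑ a, ∑ b, ∑ c, conj (S a b c) * D a b c := by
  have key := flat_first_order (fun p : α × β × γ => S p.1 p.2.1 p.2.2) (fun p => D p.1 p.2.1 p.2.2)
    (fun p => T p.1 p.2.1 p.2.2) N hN (by simpa only [Fintype.sum_prod_type] using hov)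
    (by simpa only [Fintype.sum_prod_type] using hns)
    (fun z => by simpa only [Fintype.sum_prod_type] using h z)
  simpa only [Fintype.sum_prod_type] using key

/-! ## The closed cone `C_r` and its mode deformations -/

/-- The maximiser inequality `|ov S'|² ≤ N · ns S'` passes from `{rank ≤ r}` to its closure
(`isClosed_le`, `closure_minimal`). -/
theorem max_on_closure {α β γ : Type*} [Fintype α] [Fintype β] [Fintype γ] (r : ℕ)
    (T : α → β → γ → ℂ) (N : ℝ)
    (hmax : ∀ S' : α → β → γ → ℂ, tensorRank S' ≤ r →
      ‖∑ a, ∑ b, ∑ c, S' a b c * T a b c‖ ^ 2 ≤ N * ∑ a, ∑ b, ∑ c, ‖S' a b c‖ ^ 2)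
    {S' : α → β → γ → ℂ} (h : S' ∈ closure {S' : α → β → γ → ℂ | tensorRank S' ≤ r}) :
    ‖∑ a, ∑ b, ∑ c, S' a b c * T a b c‖ ^ 2 ≤ N * ∑ a, ∑ b, ∑ c, ‖S' a b c‖ ^ 2 := by
  have hc : IsClosed {S' : α → β → γ → ℂ |
      ‖∑ a, ∑ b, ∑ c, S' a b c * T a b c‖ ^ 2 ≤ N * ∑ a, ∑ b, ∑ c, ‖S' a b c‖ ^ 2} :=
    isClosed_le (by fun_prop) (by fun_prop)
  exact closure_minimal (fun S' hS' => hmax S' hS') hc h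

/-- A mode-A deformation `S ↦ (p b c ↦ S p b c + x p · S a₀ b c)` preserves `{rank ≤ r}`: it acts on the
first factors of a triad decomposition (`exists_eq_sum_triad_of_tensorRank_le`,
`tensorRank_le_of_eq_sum`). -/
theorem tensorRank_deform_le {α β γ : Type} [Fintype α] [Fintype β] [Fintype γ] (x : α → ℂ) (a₀ : α)
    {r : ℕ} {S : α → β → γ → ℂ} (h : tensorRank S ≤ r) :
    tensorRank (fun p b c => S p b c + x p * S a₀ b c) ≤ r := by
  classical
  obtain ⟨w, u, v, rfl⟩ := exists_eq_sum_triad_of_tensorRank_le h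
  refine tensorRank_le_of_eq_sum (fun l p => w l p + x p * w l a₀) u v ?_
  funext p b c
  simp only [Finset.sum_apply, triad_apply]
  rw [Finset.mul_sum, ← Finset.sum_add_distrib]
  exact Finset.sum_congr rfl fun l _ => by ring

/-- Mode-A deformations preserve the closed cone `C_r` (`map_mem_closure`). -/
theorem deform_mem_closure {α β γ : Type} [Fintype α] [Fintype β] [Fintype γ] (x : α → ℂ) (a₀ : α)
    {r : ℕ} {S : α → β → γ → ℂ} (h : S ∈ closure {S' : α → β → γ → ℂ | tensorRank S' ≤ r}) :
    (fun p b c => S p b c + x p * S a₀ b c) ∈ closure {S' : α → β → γ → ℂ | tensorRank S' ≤ r} :=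
  map_mem_closure (f := fun (S' : α → β → γ → ℂ) p b c => S' p b c + x p * S' a₀ b c)
    (by fun_prop) h fun _ hS' => tensorRank_deform_le x a₀ hS'

/-- Swapping the first two slots preserves `{rank ≤ r}`. -/
theorem tensorRank_swap_le {α β γ : Type} [Fintype α] [Fintype β] [Fintype γ] {r : ℕ}
    {t : α → β → γ → ℂ} (h : tensorRank t ≤ r) : tensorRank (fun b a c => t a b c) ≤ r := by
  classical
  obtain ⟨w, u, v, rfl⟩ := exists_eq_sum_triad_of_tensorRank_le h
  refine tensorRank_le_of_eq_sum u w v ?_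
  funext b a c
  simp only [Finset.sum_apply, triad_apply]
  exact Finset.sum_congr rfl fun l _ => by ring

/-- Cyclically permuting the slots preserves `{rank ≤ r}`. -/
theorem tensorRank_cyc_le {α β γ : Type} [Fintype α] [Fintype β] [Fintype γ] {r : ℕ}
    {t : α → β → γ → ℂ} (h : tensorRank t ≤ r) : tensorRank (fun c a b => t a b c) ≤ r := by
  classical
  obtain ⟨w, u, v, rfl⟩ := exists_eq_sum_triad_of_tensorRank_le h
  refine tensorRank_le_of_eq_sum v w u ?_
  funext c a b
  simp only [Finset.sum_apply, triad_apply]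
  exact Finset.sum_congr rfl fun l _ => by ring

/-- Swapping the first two slots preserves the closed cone `C_r`. -/
theorem swap_mem_closure {α β γ : Type} [Fintype α] [Fintype β] [Fintype γ] {r : ℕ}
    {S : α → β → γ → ℂ} (h : S ∈ closure {S' : α → β → γ → ℂ | tensorRank S' ≤ r}) :
    (fun b a c => S a b c) ∈ closure {S' : β → α → γ → ℂ | tensorRank S' ≤ r} :=
  map_mem_closure (f := fun (S' : α → β → γ → ℂ) b a c => S' a b c) (by fun_prop) h
    fun _ hS' => tensorRank_swap_le hS'

/-- Cyclically permuting the slots preserves the closed cone `C_r`. -/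
theorem cyc_mem_closure {α β γ : Type} [Fintype α] [Fintype β] [Fintype γ] {r : ℕ}
    {S : α → β → γ → ℂ} (h : S ∈ closure {S' : α → β → γ → ℂ | tensorRank S' ≤ r}) :
    (fun c a b => S a b c) ∈ closure {S' : γ → α → β → ℂ | tensorRank S' ≤ r} :=
  map_mem_closure (f := fun (S' : α → β → γ → ℂ) c a b => S' a b c) (by fun_prop) h
    fun _ hS' => tensorRank_cyc_le hS'

/-! ## Mode A for a real tensor over arbitrary finite index types -/

/-- **Critical Gram identity, mode A.** For a real tensor `T`, a nonzero point `S` of the closed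
cone `closure {rank ≤ r}` at optimal scale (`Σ S T = Σ ‖S‖²`) maximising `|Σ S' T|² / Σ ‖S'‖²` over
rank-`≤ r` tensors satisfies `Σ_{bc} S a₀ b c conj (T a₁ b c) = Σ_{bc} S a₀ b c conj (S a₁ b c)`. -/
theorem modeA {α β γ : Type} [Fintype α] [Fintype β] [Fintype γ] (r : ℕ) (S T : α → β → γ → ℂ)
    (hT : ∀ a b c, conj (T a b c) = T a b c)
    (hcl : S ∈ closure {S' : α → β → γ → ℂ | tensorRank S' ≤ r}) (hS : S ≠ 0)
    (hov : (∑ a, ∑ b, ∑ c, S a b c * T a b c) = ((∑ a, ∑ b, ∑ c, ‖S a b c‖ ^ 2 : ℝ) : ℂ))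
    (hmax : ∀ S' : α → β → γ → ℂ, tensorRank S' ≤ r →
      ‖∑ a, ∑ b, ∑ c, S' a b c * T a b c‖ ^ 2 ≤
        (∑ a, ∑ b, ∑ c, ‖S a b c‖ ^ 2) * ∑ a, ∑ b, ∑ c, ‖S' a b c‖ ^ 2)
    (a₀ a₁ : α) :
    (∑ b, ∑ c, S a₀ b c * conj (T a₁ b c)) = ∑ b, ∑ c, S a₀ b c * conj (S a₁ b c) := by
  classical
  obtain ⟨N, hN⟩ : ∃ N : ℝ, (∑ a, ∑ b, ∑ c, ‖S a b c‖ ^ 2) = N := ⟨_, rfl⟩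
  rw [hN] at hov hmax
  have hNpos : 0 < N := hN ▸ OneStepGain.sum_norm_sq_pos_of_ne_zero S hS
  -- the direction `D := e_{a₁} ⊗ S_{a₀ • •}`
  obtain ⟨D, hD⟩ : ∃ D : α → β → γ → ℂ, ∀ p b c, D p b c = (if p = a₁ then 1 else 0) * S a₀ b c :=
    ⟨fun p b c => (if p = a₁ then 1 else 0) * S a₀ b c, fun _ _ _ => rfl⟩
  have hmem : ∀ z : ℂ, (fun p b c => S p b c + z * D p b c) ∈
      closure {S' : α → β → γ → ℂ | tensorRank S' ≤ r} := by
    intro z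
    have e : (fun p b c => S p b c + z * D p b c) =
        fun p b c => S p b c + (z * if p = a₁ then 1 else 0) * S a₀ b c := by
      funext p b c
      rw [hD, mul_assoc]
    rw [e]
    exact deform_mem_closure (fun p => z * if p = a₁ then 1 else 0) a₀ hcl
  have key := first_order S D T N hNpos hov hN fun z => max_on_closure r T N hmax (hmem z)
  have l1 : ∑ p, ∑ b, ∑ c, D p b c * T p b c = ∑ b, ∑ c, S a₀ b c * T a₁ b c := by
    rw [Fintype.sum_eq_single a₁ fun p hp => by simp [hD, hp]]
    simp [hD]
  have l2 : ∑ p, ∑ b, ∑ c, conj (S p b c) * D p b c = ∑ b, ∑ c, S a₀ b c * conj (S a₁ b c) := by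
    rw [Fintype.sum_eq_single a₁ fun p hp => by simp [hD, hp]]
    simp [hD, mul_comm]
  rw [l1, l2] at key
  rw [← key]
  exact Finset.sum_congr rfl fun b _ => Finset.sum_congr rfl fun c _ => by rw [hT]

/-! ## The stub -/

/-- stub `stub_criticalGram` of line `border-singular-values` (reshape r1) for crux `LinearDefectLaw`
(stmt-MatrixMultiplication-14039): first-order optimality of a fidelity maximiser under GL(n²)³ — the
critical Gram identity S_(p)T_(p)^* = S_(p)S_(p)^* (card critical-compression-normal-form, lever L1).
Mode A is `modeA` for `T = ⟨n,n,n⟩`; modes B and C are `modeA` for the re-indexed tensors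
`(b a c ↦ S a b c)` and `(c a b ↦ S a b c)`. -/
theorem stub_criticalGram :
    ∀ (n r : ℕ) (S : Fin n × Fin n → Fin n × Fin n → Fin n × Fin n → ℂ),
      S ∈ closure {S' : Fin n × Fin n → Fin n × Fin n → Fin n × Fin n → ℂ | tensorRank S' ≤ r} → S ≠ 0 →
      (∑ a, ∑ b, ∑ c, S a b c * matMulTensor ℂ n n n a b c) = ((∑ a, ∑ b, ∑ c, ‖S a b c‖ ^ 2 : ℝ) : ℂ) →
      (∀ S' : Fin n × Fin n → Fin n × Fin n → Fin n × Fin n → ℂ, tensorRank S' ≤ r →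
        ‖∑ a, ∑ b, ∑ c, S' a b c * matMulTensor ℂ n n n a b c‖ ^ 2 ≤
          (∑ a, ∑ b, ∑ c, ‖S a b c‖ ^ 2) * ∑ a, ∑ b, ∑ c, ‖S' a b c‖ ^ 2) →
      (∀ a a' : Fin n × Fin n, (∑ b, ∑ c, S a b c * (starRingEnd ℂ) (matMulTensor ℂ n n n a' b c)) =
          ∑ b, ∑ c, S a b c * (starRingEnd ℂ) (S a' b c)) ∧
      (∀ b b' : Fin n × Fin n, (∑ a, ∑ c, S a b c * (starRingEnd ℂ) (matMulTensor ℂ n n n a b' c)) =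
          ∑ a, ∑ c, S a b c * (starRingEnd ℂ) (S a b' c)) ∧
      (∀ c c' : Fin n × Fin n, (∑ a, ∑ b, S a b c * (starRingEnd ℂ) (matMulTensor ℂ n n n a b c')) =
          ∑ a, ∑ b, S a b c * (starRingEnd ℂ) (S a b c')) := by
  intro n r S hcl hS hov hmax
  have hT : ∀ a b c, conj (matMulTensor ℂ n n n a b c) = matMulTensor ℂ n n n a b c :=
    OneStepGain.conj_matMulTensor n
  refine ⟨fun a a' => modeA r S _ hT hcl hS hov hmax a a', fun b b' => ?_, fun c c' => ?_⟩
  · -- mode B: mode A for `(b a c ↦ S a b c)`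
    refine modeA r (fun b a c => S a b c) (fun b a c => matMulTensor ℂ n n n a b c)
      (fun b a c => hT a b c) (swap_mem_closure hcl)
      (fun h0 => hS (funext fun a => funext fun b => funext fun c => congr_fun₃ h0 b a c)) ?_ ?_ b b'
    · have e1 : (∑ b, ∑ a, ∑ c, S a b c * matMulTensor ℂ n n n a b c) =
          ∑ a, ∑ b, ∑ c, S a b c * matMulTensor ℂ n n n a b c := Finset.sum_comm
      have e2 : (∑ b, ∑ a, ∑ c, ‖S a b c‖ ^ 2) = ∑ a, ∑ b, ∑ c, ‖S a b c‖ ^ 2 := Finset.sum_comm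
      rw [e1, e2]
      exact hov
    · intro S' hS'
      have h1 := hmax (fun a b c => S' b a c) (tensorRank_swap_le hS')
      have e1 : (∑ a, ∑ b, ∑ c, S' b a c * matMulTensor ℂ n n n a b c) =
          ∑ b, ∑ a, ∑ c, S' b a c * matMulTensor ℂ n n n a b c := Finset.sum_comm
      have e2 : (∑ a, ∑ b, ∑ c, ‖S' b a c‖ ^ 2) = ∑ b, ∑ a, ∑ c, ‖S' b a c‖ ^ 2 := Finset.sum_comm
      have e3 : (∑ a, ∑ b, ∑ c, ‖S a b c‖ ^ 2) = ∑ b, ∑ a, ∑ c, ‖S a b c‖ ^ 2 := Finset.sum_comm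
      rw [e1, e2, e3] at h1
      exact h1
  · -- mode C: mode A for `(c a b ↦ S a b c)`
    refine modeA r (fun c a b => S a b c) (fun c a b => matMulTensor ℂ n n n a b c)
      (fun c a b => hT a b c) (cyc_mem_closure hcl)
      (fun h0 => hS (funext fun a => funext fun b => funext fun c => congr_fun₃ h0 c a b)) ?_ ?_ c c'
    · rw [sum_cyc fun a b c => S a b c * matMulTensor ℂ n n n a b c, sum_cyc fun a b c => ‖S a b c‖ ^ 2]
      exact hov
    · intro S' hS'
      have h1 := hmax (fun a b c => S' c a b) (tensorRank_cyc_le (tensorRank_cyc_le hS'))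
      rw [← sum_cyc (fun a b c => S' c a b * matMulTensor ℂ n n n a b c),
        ← sum_cyc (fun a b c => ‖S' c a b‖ ^ 2), ← sum_cyc (fun a b c => ‖S a b c‖ ^ 2)] at h1
      exact h1

end Summit.MatrixMultiplication.MatrixMultiplication.Theorems.LinearDefectLaw.CriticalGram
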